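import Summits.QuantumFields.YangMills.Theorems.UnitScaleGibbsBlockPlaquetteLinWeightDefs
import HarnessLib

/-!
# `UnitScaleGibbsBlockPlaquetteTransportFreeLinearisation` — THE j-FOLD, TRANSPORT-FREE LINEARISATION OF A BLOCK PLAQUETTE ON A BONDWISE-NEAR-FLAT
# TOWER: `Ū^{j}(∂a) − 1 = Σ_p linWeight j a p • (U(∂p) − 1) + O(ρ_j)` (brick (M3♭) of the S_lin stub of the crux idea «gross-sd-transfer», LINE 28 candidate)

Cell `ym3-torus` (YM ladder rung R3 = continuum SU(2) Yang–Mills on T³ — a RUNG, NOT the Clay problem: not d = 4, not infinite volume, not a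
mass gap), crux of record `UnitScaleTilt.HistoryTailL` (stmt-QuantumFields-19936), width seat `ym-ust-19936-w2` (gen 14).  `GrossTransferAnnex4.md` §6
«stub_lin» (L; *«w2∕px10 hold the pen on the engines»*) and §0 CONSTRUCTION C3: the observable is read on the axial-gauge REPRESENTATIVE, whose bond
variables (hence the bonds of every averaged level, and every transporter of the one-step engine) are near `1` on the small-field event — so the
`j`-fold linearisation needs NO transports, only the deterministic weights `linWeight j a p` of ✓`UnitScaleGibbsBlockPlaquetteLinWeightDefs`.

THE ENGINE (px10 g7, ✓p734645): `UnitScaleGibbsBlockPlaquetteOneStepFullLinearisation.norm_plaqHol_avgFun_sub_one_sub_fullLin_proxy_le` — one (0.4)+`exp[mean log]`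
averaging step: if every level-`i` plaquette deviation carries a proxy `U(∂q) − 1 = A q + R q`, `‖R q‖ ≤ ρ`, then
`‖Ū(∂p′) − 1 − |J|⁻¹ Σ_J Σ_{t,s<L} T·A(p^J_{s,t})·T*‖ ≤ 143s² + (L²a)² + L²ρ` with the EXPLICIT transporters `T = T_J·T^J_{s,t}`.  THIS FILE removes the
transporters under the hypothesis that each is within `τ` of `1` in `dist₁` (`‖T·X·T* − X‖ ≤ 2‖T − 1‖‖X‖`, and `‖A(q)‖ ≤ a + ρ`), then recognises
`|J|⁻¹ Σ_J Σ_{t,s} A(p^J_{s,t})` with `A q = Σ_p linWeight i q p • (U(∂p) − 1)` as `Σ_p linWeight (i+1) p′ p • (U(∂p) − 1)` (✓`sum_linWeight_succ_smul`), and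
iterates:

★★★ `norm_iter_plaqHol_sub_one_sub_linProxy_le` — for `V : GaugeField P 0 SU(N)` and a level `j`, IF for every `i < j` (a) every plaquette of
`V̄^{i} = Averaging.iter (blockAvg expMeanLogSU) i V` is within `a i` of `1` with `(((d+4)L)²/4)·a i ≤ δ_N/2`, (b) every one-step transporter
`T_J·T^J_{s,t}` of `V̄^{i}` (px10's letters verbatim) has `dist₁ ≤ τ i`, and (c) the budget recursion
`143·s_i² + (L²·a_i)² + L²·ρ i + L²·(2·τ_i·(a_i + ρ i)) ≤ ρ (i+1)`, `0 ≤ ρ 0`, THEN for every `q : Plaq P j`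
  `‖(V̄^{j}(∂q) : M) − 1 − Σ_{p : Plaq P 0} linWeight j q p • ((V(∂p) : M) − 1)‖ ≤ ρ j`.
GLOBAL-hypothesis form (all plaquettes ∕ transporters of the torus); the LOCAL (box) form is the same induction keyed on ✓`BlockAveragingPlaquetteBoundLocal`
and is a later pass.  Hypothesis (b) is fed, on C3's representative, by «every bond of `V̄^{i}` in the box within `η_i` of `1`» through
✓`BlockAveragingEMLLinearised.norm_holAt_sub_one_le` (`τ_i ≤ (1+η_i)^{|word|} − 1`, `|word| ≤ (d+4)L`); with `η_i ≍ L^{i}·n·θ(K)` the accumulated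
`ρ_j` is `C·(L^{j}θ(K−j)² + L^{4j}θ(K)²)`-class — windows `3j < K` ∕ `7j < K` of annex 4 §2.

WHAT THIS FILE PROVES (kernel; 0 `def`, 0 `sorry`): §1 letter `norm_mean_triple_sum_le` (transport removal `‖T·X·T* − X‖ ≤ 2‖T − 1‖‖X‖` is the tree's
✓`NewtonLiftFramed.norm_conj_sub_self_le`, re-derived as a local `have`);
§2 ★★ `norm_plaqHol_avgFun_sub_one_sub_linProxy_succ_le` (ONE level: the engine + transport removal + the weight recursion) and
★★★ `norm_iter_plaqHol_sub_one_sub_linProxy_le` (the induction over `Averaging.iter`).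

HONEST FRAMING.  Deterministic lattice bookkeeping on the tree's own objects (`--supports stmt-QuantumFields-19936`); proves no stub, crux, rung or
summit statement; stub_lin (which also needs the LOCAL form, the decay (W-P4) `linWeight ≤ c·L^{−j}`, and the `dist₁`∕flux identification), (A),
«ShallowFluxSecondMomentL», (Q), K1, `MeanDeviationL`, `HistoryTailL` are NOT proved; the Yang–Mills mass gap is NOT proved.

References: [Balaban1985Averaging] T. Bałaban, CMP 98 (1985) 17–51, (47)–(48) pp. 25–26, (124) p. 36; [Balaban1987RG1] T. Bałaban, CMP 109 (1987)
249–301, (0.3)–(0.4), (0.11) pp. 252–253.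
-/

noncomputable section

open scoped BigOperators

namespace Summit.QuantumFields.YangMills.Theorems.UnitScaleGibbsBlockPlaquetteTransportFreeLinearisation

open Literature.MathematicalPhysics.QuantumFieldTheory.Balaban1983to89
open Literature.MathematicalPhysics.QuantumFieldTheory.Balaban1983to89.B10Eq47AxialChi (shiftN rowProd)
open Literature.MathematicalPhysics.QuantumFieldTheory.Balaban1983to89.BlockAveraging (avgFun off blockAvg)
open Literature.MathematicalPhysics.QuantumFieldTheory.Balaban1983to89.ExpMeanLog (expMeanLogSU deltaSU)
open T4Continuum (holAt walk walkEnd stairWord)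
open Summit.QuantumFields.YangMills.Theorems.UnitScaleGibbsBlockPlaquetteLinWeight
open Summit.QuantumFields.YangMills.Theorems.UnitScaleGibbsBlockPlaquetteOneStepFullLinearisation (norm_plaqHol_avgFun_sub_one_sub_fullLin_proxy_le)

/-! ## §1 Letters -/

section Letters

open scoped Matrix.Norms.L2Operator

variable {n : Type*} [Fintype n] [DecidableEq n]

/-- Elements of `SU(N)` are unitary matrices. [folklore] -/
private theorem coe_mem_unitaryGroup (g : Matrix.specialUnitaryGroup n ℂ) : (g : Matrix n n ℂ) ∈ Matrix.unitaryGroup n ℂ :=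
  (Matrix.mem_specialUnitaryGroup_iff.1 g.2).1

/-- `‖g‖ ≤ 1`-type facts: `‖star g‖ = 1` for `g ∈ SU(N)` (nonempty `n`). [folklore] -/
private theorem norm_star_coe_eq_one [Nonempty n] (g : Matrix.specialUnitaryGroup n ℂ) : ‖star (g : Matrix n n ℂ)‖ = 1 :=
  CStarRing.norm_of_mem_unitary (coe_mem_unitaryGroup g⁻¹)

/-- A mean over a finite index of double sums over `range L × range L` of terms of norm `≤ B` has norm `≤ L²·B`. [folklore] -/
theorem norm_mean_triple_sum_le {ι : Type*} [Fintype ι] [Nonempty ι] {L : ℕ} (E : ι → ℕ → ℕ → Matrix n n ℂ) {B : ℝ}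
    (hE : ∀ i, ∀ t, t < L → ∀ s, s < L → ‖E i t s‖ ≤ B) :
    ‖((Fintype.card ι : ℂ))⁻¹ • ∑ i, ∑ t ∈ Finset.range L, ∑ s ∈ Finset.range L, E i t s‖ ≤ ((L * L : ℕ) : ℝ) * B := by
  have hc : (0 : ℝ) < Fintype.card ι := Nat.cast_pos.mpr Fintype.card_pos
  have hrow : ∀ i, ‖∑ t ∈ Finset.range L, ∑ s ∈ Finset.range L, E i t s‖ ≤ ((L * L : ℕ) : ℝ) * B := fun i =>
    calc ‖∑ t ∈ Finset.range L, ∑ s ∈ Finset.range L, E i t s‖ ≤ ∑ t ∈ Finset.range L, ‖∑ s ∈ Finset.range L, E i t s‖ := norm_sum_le _ _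
      _ ≤ ∑ t ∈ Finset.range L, ∑ s ∈ Finset.range L, ‖E i t s‖ := Finset.sum_le_sum fun t _ => norm_sum_le _ _
      _ ≤ ∑ t ∈ Finset.range L, ∑ s ∈ Finset.range L, B :=
          Finset.sum_le_sum fun t ht => Finset.sum_le_sum fun s hs => hE i t (Finset.mem_range.1 ht) s (Finset.mem_range.1 hs)
      _ = ((L * L : ℕ) : ℝ) * B := by simp [Finset.sum_const, Finset.card_range]; ring
  have hsum : ∑ i, ‖∑ t ∈ Finset.range L, ∑ s ∈ Finset.range L, E i t s‖ ≤ ∑ _i : ι, ((L * L : ℕ) : ℝ) * B :=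
    Finset.sum_le_sum fun i _ => hrow i
  rw [Finset.sum_const, Finset.card_univ, nsmul_eq_mul] at hsum
  rw [norm_smul, norm_inv, Complex.norm_natCast, inv_mul_le_iff₀ hc]
  exact (norm_sum_le _ _).trans hsum

end Letters

/-! ## §2 One level, then the induction -/

section Main

open scoped Matrix.Norms.L2Operator

variable {n : Type*} [Fintype n] [DecidableEq n] [Nonempty n] {P : Params}

/-- **ONE LEVEL, TRANSPORT-FREE**: if every plaquette of the level-`i` field `U` is within `a` of `1` (`(((d+4)L)²/4)·a ≤ δ_N/2`), every level-`i`
plaquette deviation is within `ρ` of the linear proxy `Σ_p w q p • X p`, and every one-step transporter `T_J·T^J_{s,t}` of `U` is within `τ` of `1`,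
then the coarse plaquette deviation is within `143s² + (L²a)² + L²ρ + L²·2τ(a + ρ)` of the proxy with the one-level-up weights
`|J|⁻¹ Σ_J Σ_{t,s} w (p^J_{s,t}) p` (px10's (S)-engine + transport removal + sum interchange). [cite: Balaban1985Averaging, (47)-(48) pp.25-26 and (124) p.36; Balaban1987RG1, (0.3)-(0.4) pp.252-253] -/
theorem norm_plaqHol_avgFun_sub_one_sub_linProxy_succ_le {i : ℕ} {a ρ τ : ℝ} (ha : 0 ≤ a)
    {U : GaugeField P i (Matrix.specialUnitaryGroup n ℂ)}
    (hU : ∀ q : Plaq P i, dist1 (GaugeField.plaqHol U q) ≤ a)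
    (hs : ((((P.d + 4) * P.L : ℕ) : ℝ) ^ 2 / 4) * a ≤ deltaSU n / 2)
    (w : Plaq P i → Plaq P 0 → ℝ) (X : Plaq P 0 → Matrix n n ℂ)
    (hw : ∀ q : Plaq P i, ‖(((GaugeField.plaqHol U q : Matrix.specialUnitaryGroup n ℂ) : Matrix n n ℂ) - 1) -
      ∑ p : Plaq P 0, ((w q p : ℝ) : ℂ) • X p‖ ≤ ρ)
    (hτ : ∀ (y : Site P (i + 1)) (μ ν : Fin P.d)
      (J : (Fin P.d → Fin P.L) × Equiv.Perm (Fin P.d) × Equiv.Perm (Fin P.d) × Equiv.Perm (Fin P.d) × Equiv.Perm (Fin P.d)) (t s : ℕ),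
      t < P.L → s < P.L →
      dist1 (holAt U (walk (emb y) (stairWord J.2.1 (off J.1))) *
        (rowProd U (walkEnd (emb y) (stairWord J.2.1 (off J.1))) ν t *
          rowProd U (shiftN (walkEnd (emb y) (stairWord J.2.1 (off J.1))) ν t) μ s)) ≤ τ)
    (y : Site P (i + 1)) {μ ν : Fin P.d} (hμν : μ < ν) :
    ‖(((GaugeField.plaqHol (avgFun (expMeanLogSU (n := n)) U) ⟨y, μ, ν, hμν⟩ : Matrix.specialUnitaryGroup n ℂ) : Matrix n n ℂ) - 1) -
        ((Fintype.card ((Fin P.d → Fin P.L) × Equiv.Perm (Fin P.d) × Equiv.Perm (Fin P.d) × Equiv.Perm (Fin P.d) ×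
          Equiv.Perm (Fin P.d)) : ℂ))⁻¹ •
          ∑ J : (Fin P.d → Fin P.L) × Equiv.Perm (Fin P.d) × Equiv.Perm (Fin P.d) × Equiv.Perm (Fin P.d) × Equiv.Perm (Fin P.d),
            ∑ t ∈ Finset.range P.L, ∑ s ∈ Finset.range P.L,
              ∑ p : Plaq P 0, ((w ⟨shiftN (shiftN (walkEnd (emb y) (stairWord J.2.1 (off J.1))) ν t) μ s, μ, ν, hμν⟩ p : ℝ) : ℂ) • X p‖ ≤
      143 * (((((P.d + 4) * P.L : ℕ) : ℝ) ^ 2 / 4) * a) ^ 2 + (((P.L * P.L : ℕ) : ℝ) * a) ^ 2 + ((P.L * P.L : ℕ) : ℝ) * ρ +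
        ((P.L * P.L : ℕ) : ℝ) * (2 * τ * (a + ρ)) := by
  haveI : Nonempty (Fin P.d → Fin P.L) := ⟨fun _ => ⟨0, P.L_pos⟩⟩
  -- the proxy and its remainder
  set A : Plaq P i → Matrix n n ℂ := fun q => ∑ p : Plaq P 0, ((w q p : ℝ) : ℂ) • X p with hA
  set R : Plaq P i → Matrix n n ℂ := fun q => (((GaugeField.plaqHol U q : Matrix.specialUnitaryGroup n ℂ) : Matrix n n ℂ) - 1) - A q with hR
  have hAR : ∀ q : Plaq P i, (((GaugeField.plaqHol U q : Matrix.specialUnitaryGroup n ℂ) : Matrix n n ℂ) - 1) = A q + R q := fun q => by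
    simp only [hR]; abel
  have hRρ : ∀ q, ‖R q‖ ≤ ρ := fun q => hw q
  have hAq : ∀ q, ‖A q‖ ≤ a + ρ := fun q => by
    have e : A q = (((GaugeField.plaqHol U q : Matrix.specialUnitaryGroup n ℂ) : Matrix n n ℂ) - 1) - R q := by rw [hAR q]; abel
    rw [e]
    refine (norm_sub_le _ _).trans (add_le_add ?_ (hRρ q))
    rw [← FederbushMean.dist1_SU_eq]; exact hU q
  -- the engine
  have hK := norm_plaqHol_avgFun_sub_one_sub_fullLin_proxy_le ha hU hs A R hAR hRρ y hμν
  -- transport removal, term by term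
  set T : (Fin P.d → Fin P.L) × Equiv.Perm (Fin P.d) × Equiv.Perm (Fin P.d) × Equiv.Perm (Fin P.d) × Equiv.Perm (Fin P.d) → ℕ → ℕ →
      Matrix.specialUnitaryGroup n ℂ := fun J t s =>
    holAt U (walk (emb y) (stairWord J.2.1 (off J.1))) *
      (rowProd U (walkEnd (emb y) (stairWord J.2.1 (off J.1))) ν t *
        rowProd U (shiftN (walkEnd (emb y) (stairWord J.2.1 (off J.1))) ν t) μ s) with hT
  set q : (Fin P.d → Fin P.L) × Equiv.Perm (Fin P.d) × Equiv.Perm (Fin P.d) × Equiv.Perm (Fin P.d) × Equiv.Perm (Fin P.d) → ℕ → ℕ → Plaq P i :=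
    fun J t s => ⟨shiftN (shiftN (walkEnd (emb y) (stairWord J.2.1 (off J.1))) ν t) μ s, μ, ν, hμν⟩ with hq
  -- transport removal `‖T·X·T* − X‖ ≤ 2‖T − 1‖‖X‖` (the tree's ✓`NewtonLiftFramed.norm_conj_sub_self_le`, re-derived locally to keep the import closure small)
  have hconj : ∀ (T : Matrix.specialUnitaryGroup n ℂ) (X : Matrix n n ℂ),
      ‖(T : Matrix n n ℂ) * X * star (T : Matrix n n ℂ) - X‖ ≤ 2 * ‖(T : Matrix n n ℂ) - 1‖ * ‖X‖ := fun T X => by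
    have e : (T : Matrix n n ℂ) * X * star (T : Matrix n n ℂ) - X =
        ((T : Matrix n n ℂ) - 1) * X * star (T : Matrix n n ℂ) + X * (star (T : Matrix n n ℂ) - 1) := by noncomm_ring
    rw [e]
    calc ‖((T : Matrix n n ℂ) - 1) * X * star (T : Matrix n n ℂ) + X * (star (T : Matrix n n ℂ) - 1)‖
        ≤ ‖(T : Matrix n n ℂ) - 1‖ * ‖X‖ * ‖star (T : Matrix n n ℂ)‖ + ‖X‖ * ‖star (T : Matrix n n ℂ) - 1‖ :=
          (norm_add_le _ _).trans (add_le_add ((norm_mul_le _ _).trans (mul_le_mul_of_nonneg_right (norm_mul_le _ _) (norm_nonneg _)))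
            (norm_mul_le _ _))
      _ = 2 * ‖(T : Matrix n n ℂ) - 1‖ * ‖X‖ := by rw [norm_star_coe_eq_one, ExpMeanLog.norm_star_sub_one]; ring
  have hdiff : ‖((Fintype.card ((Fin P.d → Fin P.L) × Equiv.Perm (Fin P.d) × Equiv.Perm (Fin P.d) × Equiv.Perm (Fin P.d) ×
          Equiv.Perm (Fin P.d)) : ℂ))⁻¹ •
          ∑ J : (Fin P.d → Fin P.L) × Equiv.Perm (Fin P.d) × Equiv.Perm (Fin P.d) × Equiv.Perm (Fin P.d) × Equiv.Perm (Fin P.d),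
            ∑ t ∈ Finset.range P.L, ∑ s ∈ Finset.range P.L,
              (((T J t s : Matrix.specialUnitaryGroup n ℂ) : Matrix n n ℂ) * A (q J t s) * star ((T J t s : Matrix.specialUnitaryGroup n ℂ) : Matrix n n ℂ) -
                A (q J t s))‖ ≤ ((P.L * P.L : ℕ) : ℝ) * (2 * τ * (a + ρ)) := by
    refine norm_mean_triple_sum_le _ fun J t ht s hs' => ?_
    refine (hconj (T J t s) (A (q J t s))).trans ?_
    have h1 : ‖((T J t s : Matrix.specialUnitaryGroup n ℂ) : Matrix n n ℂ) - 1‖ ≤ τ := by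
      have h := hτ y μ ν J t s ht hs'
      rw [FederbushMean.dist1_SU_eq] at h
      exact h
    have h2 := hAq (q J t s)
    have hτ0 : 0 ≤ τ := (GaugeGroup.dist1_nonneg _).trans (hτ y μ ν J t s ht hs')
    calc 2 * ‖((T J t s : Matrix.specialUnitaryGroup n ℂ) : Matrix n n ℂ) - 1‖ * ‖A (q J t s)‖ ≤ 2 * τ * (a + ρ) := by
          gcongr
    _ = 2 * τ * (a + ρ) := rfl
  -- assemble: (full transported sum) − (transport-free sum) = the mean of the differences
  have esplit : ((Fintype.card ((Fin P.d → Fin P.L) × Equiv.Perm (Fin P.d) × Equiv.Perm (Fin P.d) × Equiv.Perm (Fin P.d) ×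
          Equiv.Perm (Fin P.d)) : ℂ))⁻¹ •
          ∑ J : (Fin P.d → Fin P.L) × Equiv.Perm (Fin P.d) × Equiv.Perm (Fin P.d) × Equiv.Perm (Fin P.d) × Equiv.Perm (Fin P.d),
            ∑ t ∈ Finset.range P.L, ∑ s ∈ Finset.range P.L,
              ((T J t s : Matrix.specialUnitaryGroup n ℂ) : Matrix n n ℂ) * A (q J t s) * star ((T J t s : Matrix.specialUnitaryGroup n ℂ) : Matrix n n ℂ) -
        ((Fintype.card ((Fin P.d → Fin P.L) × Equiv.Perm (Fin P.d) × Equiv.Perm (Fin P.d) × Equiv.Perm (Fin P.d) ×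
          Equiv.Perm (Fin P.d)) : ℂ))⁻¹ •
          ∑ J : (Fin P.d → Fin P.L) × Equiv.Perm (Fin P.d) × Equiv.Perm (Fin P.d) × Equiv.Perm (Fin P.d) × Equiv.Perm (Fin P.d),
            ∑ t ∈ Finset.range P.L, ∑ s ∈ Finset.range P.L, A (q J t s) =
      ((Fintype.card ((Fin P.d → Fin P.L) × Equiv.Perm (Fin P.d) × Equiv.Perm (Fin P.d) × Equiv.Perm (Fin P.d) ×
          Equiv.Perm (Fin P.d)) : ℂ))⁻¹ •
          ∑ J : (Fin P.d → Fin P.L) × Equiv.Perm (Fin P.d) × Equiv.Perm (Fin P.d) × Equiv.Perm (Fin P.d) × Equiv.Perm (Fin P.d),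
            ∑ t ∈ Finset.range P.L, ∑ s ∈ Finset.range P.L,
              (((T J t s : Matrix.specialUnitaryGroup n ℂ) : Matrix n n ℂ) * A (q J t s) * star ((T J t s : Matrix.specialUnitaryGroup n ℂ) : Matrix n n ℂ) -
                A (q J t s)) := by
    rw [← smul_sub, ← Finset.sum_sub_distrib]
    congr 1
    refine Finset.sum_congr rfl fun J _ => ?_
    rw [← Finset.sum_sub_distrib]
    refine Finset.sum_congr rfl fun t _ => ?_
    rw [← Finset.sum_sub_distrib]
  -- the target's proxy term IS the transport-free sum (definitionally, through `hA`/`hq`)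
  have key := norm_sub_le_norm_sub_add_norm_sub
    ((((GaugeField.plaqHol (avgFun (expMeanLogSU (n := n)) U) ⟨y, μ, ν, hμν⟩ : Matrix.specialUnitaryGroup n ℂ) : Matrix n n ℂ) - 1))
    (((Fintype.card ((Fin P.d → Fin P.L) × Equiv.Perm (Fin P.d) × Equiv.Perm (Fin P.d) × Equiv.Perm (Fin P.d) ×
          Equiv.Perm (Fin P.d)) : ℂ))⁻¹ •
          ∑ J : (Fin P.d → Fin P.L) × Equiv.Perm (Fin P.d) × Equiv.Perm (Fin P.d) × Equiv.Perm (Fin P.d) × Equiv.Perm (Fin P.d),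
            ∑ t ∈ Finset.range P.L, ∑ s ∈ Finset.range P.L,
              ((T J t s : Matrix.specialUnitaryGroup n ℂ) : Matrix n n ℂ) * A (q J t s) * star ((T J t s : Matrix.specialUnitaryGroup n ℂ) : Matrix n n ℂ))
    (((Fintype.card ((Fin P.d → Fin P.L) × Equiv.Perm (Fin P.d) × Equiv.Perm (Fin P.d) × Equiv.Perm (Fin P.d) ×
          Equiv.Perm (Fin P.d)) : ℂ))⁻¹ •
          ∑ J : (Fin P.d → Fin P.L) × Equiv.Perm (Fin P.d) × Equiv.Perm (Fin P.d) × Equiv.Perm (Fin P.d) × Equiv.Perm (Fin P.d),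
            ∑ t ∈ Finset.range P.L, ∑ s ∈ Finset.range P.L, A (q J t s))
  rw [esplit] at key
  have hK' : ‖(((GaugeField.plaqHol (avgFun (expMeanLogSU (n := n)) U) ⟨y, μ, ν, hμν⟩ : Matrix.specialUnitaryGroup n ℂ) : Matrix n n ℂ) - 1) -
      ((Fintype.card ((Fin P.d → Fin P.L) × Equiv.Perm (Fin P.d) × Equiv.Perm (Fin P.d) × Equiv.Perm (Fin P.d) ×
          Equiv.Perm (Fin P.d)) : ℂ))⁻¹ •
          ∑ J : (Fin P.d → Fin P.L) × Equiv.Perm (Fin P.d) × Equiv.Perm (Fin P.d) × Equiv.Perm (Fin P.d) × Equiv.Perm (Fin P.d),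
            ∑ t ∈ Finset.range P.L, ∑ s ∈ Finset.range P.L,
              ((T J t s : Matrix.specialUnitaryGroup n ℂ) : Matrix n n ℂ) * A (q J t s) * star ((T J t s : Matrix.specialUnitaryGroup n ℂ) : Matrix n n ℂ)‖ ≤
      143 * (((((P.d + 4) * P.L : ℕ) : ℝ) ^ 2 / 4) * a) ^ 2 + (((P.L * P.L : ℕ) : ℝ) * a) ^ 2 + ((P.L * P.L : ℕ) : ℝ) * ρ := by
    simpa only [hT, hq] using hK
  have hgoal : ‖(((GaugeField.plaqHol (avgFun (expMeanLogSU (n := n)) U) ⟨y, μ, ν, hμν⟩ : Matrix.specialUnitaryGroup n ℂ) : Matrix n n ℂ) - 1) -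
      ((Fintype.card ((Fin P.d → Fin P.L) × Equiv.Perm (Fin P.d) × Equiv.Perm (Fin P.d) × Equiv.Perm (Fin P.d) ×
          Equiv.Perm (Fin P.d)) : ℂ))⁻¹ •
          ∑ J : (Fin P.d → Fin P.L) × Equiv.Perm (Fin P.d) × Equiv.Perm (Fin P.d) × Equiv.Perm (Fin P.d) × Equiv.Perm (Fin P.d),
            ∑ t ∈ Finset.range P.L, ∑ s ∈ Finset.range P.L, A (q J t s)‖ ≤
      143 * (((((P.d + 4) * P.L : ℕ) : ℝ) ^ 2 / 4) * a) ^ 2 + (((P.L * P.L : ℕ) : ℝ) * a) ^ 2 + ((P.L * P.L : ℕ) : ℝ) * ρ +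
        ((P.L * P.L : ℕ) : ℝ) * (2 * τ * (a + ρ)) := by
    linarith [key, hK', hdiff]
  simpa only [hA, hq] using hgoal

/-- ★★★ **THE j-FOLD, TRANSPORT-FREE LINEARISATION OF A BLOCK PLAQUETTE ON A BONDWISE-NEAR-FLAT TOWER.**  Let `V : GaugeField P 0 SU(N)` and
`V̄^{i} := Averaging.iter (blockAvg expMeanLogSU) i V` its (0.4)+`exp[mean log]` tower.  Suppose that for every level `i < j`: (a) every plaquette
of `V̄^{i}` is within `a i` of `1`, `0 ≤ a i`, `(((d+4)L)²/4)·a i ≤ δ_N/2`; (b) every one-step transporter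
`holAt V̄^{i} (walk (emb y) (stairWord σ (off r))) · rowProd V̄^{i} x_J ν t · rowProd V̄^{i} (x_J + t e_ν) μ s` (`t, s < L`) is within `τ i` of `1` in `dist₁`;
(c) the budgets satisfy `0 ≤ ρ 0` and `143·s_i² + (L²·a_i)² + L²·ρ i + L²·(2·τ_i·(a_i + ρ i)) ≤ ρ (i+1)`.  Then for every `q : Plaq P j`
  `‖(V̄^{j}(∂q) : M) − 1 − Σ_{p : Plaq P 0} linWeight j q p • ((V(∂p) : M) − 1)‖ ≤ ρ j`
— the block plaquette deviation IS the `linWeight`-weighted sum of the fine plaquette deviations, with NO transports, up to the accumulated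
second-order budget (C3: all transporters are near `1` on the axial-gauge representative). [cite: Balaban1985Averaging, (47)-(48) pp.25-26 and (124) p.36; Balaban1987RG1, (0.3)-(0.4) and (0.11) pp.252-253] -/
theorem norm_iter_plaqHol_sub_one_sub_linProxy_le (V : GaugeField P 0 (Matrix.specialUnitaryGroup n ℂ)) (a τ ρ : ℕ → ℝ) :
    ∀ j : ℕ,
      (∀ i, i < j → 0 ≤ a i) →
      (∀ i, i < j → ∀ q : Plaq P i,
        dist1 (GaugeField.plaqHol (Averaging.iter (fun i' => blockAvg (P := P) (j := i') (expMeanLogSU (n := n))) i V) q) ≤ a i) →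
      (∀ i, i < j → ((((P.d + 4) * P.L : ℕ) : ℝ) ^ 2 / 4) * a i ≤ deltaSU n / 2) →
      (∀ i, i < j → ∀ (y : Site P (i + 1)) (μ ν : Fin P.d)
        (J : (Fin P.d → Fin P.L) × Equiv.Perm (Fin P.d) × Equiv.Perm (Fin P.d) × Equiv.Perm (Fin P.d) × Equiv.Perm (Fin P.d)) (t s : ℕ),
        t < P.L → s < P.L →
        dist1 (holAt (Averaging.iter (fun i' => blockAvg (P := P) (j := i') (expMeanLogSU (n := n))) i V)
            (walk (emb y) (stairWord J.2.1 (off J.1))) *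
          (rowProd (Averaging.iter (fun i' => blockAvg (P := P) (j := i') (expMeanLogSU (n := n))) i V)
              (walkEnd (emb y) (stairWord J.2.1 (off J.1))) ν t *
            rowProd (Averaging.iter (fun i' => blockAvg (P := P) (j := i') (expMeanLogSU (n := n))) i V)
              (shiftN (walkEnd (emb y) (stairWord J.2.1 (off J.1))) ν t) μ s)) ≤ τ i) →
      0 ≤ ρ 0 →
      (∀ i, i < j → 143 * (((((P.d + 4) * P.L : ℕ) : ℝ) ^ 2 / 4) * a i) ^ 2 + (((P.L * P.L : ℕ) : ℝ) * a i) ^ 2 +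
        ((P.L * P.L : ℕ) : ℝ) * ρ i + ((P.L * P.L : ℕ) : ℝ) * (2 * τ i * (a i + ρ i)) ≤ ρ (i + 1)) →
      ∀ q : Plaq P j,
        ‖(((GaugeField.plaqHol (Averaging.iter (fun i' => blockAvg (P := P) (j := i') (expMeanLogSU (n := n))) j V) q :
            Matrix.specialUnitaryGroup n ℂ) : Matrix n n ℂ) - 1) -
          ∑ p : Plaq P 0, ((linWeight j q p : ℝ) : ℂ) •
            ((((GaugeField.plaqHol V p : Matrix.specialUnitaryGroup n ℂ)) : Matrix n n ℂ) - 1)‖ ≤ ρ j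
  | 0, _, _, _, _, hρ0, _, q => by
    have e : Averaging.iter (fun i' => blockAvg (P := P) (j := i') (expMeanLogSU (n := n))) 0 V = V := rfl
    rw [e, sum_linWeight_zero_smul, sub_self, norm_zero]
    exact hρ0
  | j + 1, ha, hplaq, hs, hτ, hρ0, hstep, q => by
    -- the induction hypothesis at level `j`
    have IH := norm_iter_plaqHol_sub_one_sub_linProxy_le V a τ ρ j (fun i hi => ha i (Nat.lt_succ_of_lt hi))
      (fun i hi => hplaq i (Nat.lt_succ_of_lt hi)) (fun i hi => hs i (Nat.lt_succ_of_lt hi)) (fun i hi => hτ i (Nat.lt_succ_of_lt hi)) hρ0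
      (fun i hi => hstep i (Nat.lt_succ_of_lt hi))
    obtain ⟨y, μ, ν, hμν⟩ := q
    have e : Averaging.iter (fun i' => blockAvg (P := P) (j := i') (expMeanLogSU (n := n))) (j + 1) V =
        avgFun (expMeanLogSU (n := n)) (Averaging.iter (fun i' => blockAvg (P := P) (j := i') (expMeanLogSU (n := n))) j V) := rfl
    rw [e]
    have h1 := norm_plaqHol_avgFun_sub_one_sub_linProxy_succ_le (ha j (Nat.lt_succ_self j)) (hplaq j (Nat.lt_succ_self j))
      (hs j (Nat.lt_succ_self j)) (linWeight j)
      (fun p => (((GaugeField.plaqHol V p : Matrix.specialUnitaryGroup n ℂ)) : Matrix n n ℂ) - 1) IH (hτ j (Nat.lt_succ_self j)) y hμν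
    rw [sum_linWeight_succ_smul]
    exact h1.trans (hstep j (Nat.lt_succ_self j))

end Main

end Summit.QuantumFields.YangMills.Theorems.UnitScaleGibbsBlockPlaquetteTransportFreeLinearisation

end
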